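import Literature.NumberTheory.LFunctions.GuthMaynardPrimeCorollaries
import Literature.NumberTheory.LFunctions.PrimeCountingShortIntervalTransfer
import HarnessLib

/-!
# Guth–Maynard Corollary 1.3 (primes in all short intervals `[x, x + x^{17/30+ε}]`) from its `ψ`-form

NOT RH-BEARING. Corollary 1.3 is a theorem about PRIMES in short intervals (RH-free literature); a
zero-density theorem counts zeros off the critical line, it never empties the strip
(`Literature.Barriers.RiemannHypothesis.LindelofBacklund`). bears_on: LADDER-RH §4 HELD row
`DensityLadder` (corpus C4, formalisation record only). Nothing here bears on the truth of RH.

Topic `Literature/NumberTheory/LFunctions`. Pure-proof file (theorems only).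

Source: L. Guth, J. Maynard, *New large value estimates for Dirichlet polynomials*, Ann. of Math. (2)
203 (2026) 623–675 = arXiv:2405.20552, Cor. 1.3 (p. 3) and §13.2, first paragraph (p. 29 of the arXiv
version): "These are well-known to follow quickly from (30/13), but for completeness we give a proof.
By partial summation, it suffices to prove corresponding results for the Von Mangoldt function in place
of the prime indicator function."  This file IS that partial-summation step, for Cor. 1.3:

* `GuthMaynard2026_corollary_1_3_of_psiShortIntervals :
    GuthMaynard2026_psiShortIntervals → GuthMaynard2026_corollary_1_3`

where both `Prop`s are the as-printed statements of `GuthMaynardPrimeCorollaries.lean` (WP-C0):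
`ψ(x+y) − ψ(x) = y + O_ε(y e^{−A(log x)^{1/4}})` (used at the printed instance `A = 1`) and
`π(x+y) − π(x) = y/log x + O_ε(y e^{−(log x)^{1/4}})`, `y ∈ [x^{17/30+ε}, x^{0.99}]`.
The pointwise transfer (`|π(x+y) − π(x) − y/log x| ≤ (|ψ(x+y) − ψ(x) − y| + 2√(x+y) log(x+y))/log x
+ y²/(x log²x)`) and the growth bookkeeping (`exp((log x)^{1/4}) ≤ x^{1/100}` eventually) are the
SIG-agnostic lemmas of `PrimeCountingShortIntervalTransfer.lean` (namespace `PrimeWindow`).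

The `ψ`-statement itself (explicit formula + the 30/13 density estimate + a near-`σ = 1` density bound +
the Vinogradov–Korobov region, GM §13.2) is WP-C1 (`GuthMaynardPsiShortIntervalsProofs.lean`); the
composition `NearOneZeroDensity → Cor. 1.3` and the unconditional `GuthMaynard2026_corollary_1_3_holds`
are appended here when those files land (append protocol).

## References

* [GuthMaynard2026] L. Guth, J. Maynard, Ann. of Math. (2) 203 (2026) 623–675, Cor. 1.3, §13.2.
-/

noncomputable section

open Finset Real
open scoped Chebyshev Nat.Prime

namespace Literature.NumberTheory.LFunctions

/-! ### Corollary 1.3 from its `ψ`-form -/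

/-- **Guth–Maynard Cor. 1.3 from its `ψ`-form** (the "By partial summation" step of §13.2, p. 29 of
arXiv:2405.20552): if `ψ(x+y) − ψ(x) = y + O_ε(y e^{−(log x)^{1/4}})` for `y ∈ [x^{17/30+ε}, x^{0.99}]`
(`GuthMaynard2026_psiShortIntervals`, instance `A = 1`), then
`π(x+y) − π(x) = y/log x + O_ε(y e^{−(log x)^{1/4}})` in the same range (`GuthMaynard2026_corollary_1_3`).
Constants: `C' = max C 0 + 7`, `x ≥ max(x₀, x₁(1/100), e)` where `exp((log x)^{1/4}) ≤ x^{1/100}` for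
`x ≥ x₁`; the three terms of `PrimeWindow.abs_primeCounting_window_sub_le_of_psi` are bounded by
`C₀ y E`, `6√x ≤ 6 y E` (`x^{1/2} ≤ x^{17/30 − 1/100}`) and `y²/(x log²x) ≤ y x^{−1/100} ≤ y E`,
`E = e^{−(log x)^{1/4}}`. NOT RH-BEARING (a theorem about primes in short intervals, RH-free).
[cite: GuthMaynard2026, §13.2 (proof of Cor. 1.3)] -/
theorem GuthMaynard2026_corollary_1_3_of_psiShortIntervals (h : GuthMaynard2026_psiShortIntervals) :
    GuthMaynard2026_corollary_1_3 := by
  intro ε hε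
  obtain ⟨C, x₀, hC⟩ := h ε hε 1
  obtain ⟨x₁, hx₁⟩ :=
    PrimeWindow.exists_exp_log_rpow_le_rpow (a := 1 / 100) (κ := 1 / 4) (by norm_num) (by norm_num)
  refine ⟨max C 0 + 7, max (max x₀ x₁) (Real.exp 1), fun x hx y hy1 hy2 => ?_⟩
  have hxx₀ : x₀ ≤ x := ((le_max_left _ _).trans (le_max_left _ _)).trans hx
  have hxx₁ : x₁ ≤ x := ((le_max_right _ _).trans (le_max_left _ _)).trans hx
  have hxe : Real.exp 1 ≤ x := (le_max_right _ _).trans hx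
  have hx2 : 2 ≤ x := by linarith [Real.add_one_le_exp (1 : ℝ)]
  have hx1 : 1 < x := by linarith
  have hx0 : 0 < x := by linarith
  have hL1 : 1 ≤ Real.log x := by rwa [Real.le_log_iff_exp_le hx0]
  have hL0 : 0 < Real.log x := by linarith
  set L : ℝ := Real.log x with hLdef
  set E : ℝ := Real.exp (-L ^ (1 / 4 : ℝ)) with hEdef
  have hE0 : 0 < E := Real.exp_pos _
  -- `x^{-1/100} ≤ E`
  have hkey : Real.exp (L ^ (1 / 4 : ℝ)) ≤ x ^ (1 / 100 : ℝ) := hx₁ x hxx₁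
  have hEx : x ^ (-(1 / 100) : ℝ) ≤ E := by
    rw [hEdef, Real.exp_neg, Real.rpow_neg hx0.le]
    exact inv_anti₀ (Real.exp_pos _) hkey
  -- `y > 0`, `y ≤ x`
  have hy0 : 0 < y := lt_of_lt_of_le (Real.rpow_pos_of_pos hx0 _) hy1
  have hyx : y ≤ x := hy2.trans (by
    calc x ^ (99 / 100 : ℝ) ≤ x ^ (1 : ℝ) := Real.rpow_le_rpow_of_exponent_le hx1.le (by norm_num)
      _ = x := Real.rpow_one x)
  -- the hypothesis at `A = 1`, with `C` replaced by `max C 0`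
  have hψ : |ψ (x + y) - ψ x - y| ≤ max C 0 * y * E := by
    have h0 := hC x hxx₀ y hy1 hy2
    rw [neg_one_mul] at h0
    calc |ψ (x + y) - ψ x - y| ≤ C * y * E := h0
      _ ≤ max C 0 * y * E := by gcongr; exact le_max_left _ _
  -- term 1
  have h1 : |ψ (x + y) - ψ x - y| / L ≤ max C 0 * y * E := by
    rw [div_le_iff₀ hL0]
    calc |ψ (x + y) - ψ x - y| ≤ max C 0 * y * E := hψ
      _ = max C 0 * y * E * 1 := (mul_one _).symm
      _ ≤ max C 0 * y * E * L := by gcongr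
  -- term 2: `2√(x+y) log(x+y) / L ≤ 6 √x ≤ 6 y E`
  have hsqrt : Real.sqrt (x + y) ≤ 3 / 2 * Real.sqrt x := by
    rw [show (3 / 2 : ℝ) * Real.sqrt x = Real.sqrt ((3 / 2) ^ 2 * x) by
      rw [Real.sqrt_mul' _ hx0.le, Real.sqrt_sq (by norm_num)]]
    exact Real.sqrt_le_sqrt (by nlinarith)
  have hlog2 : Real.log (x + y) ≤ 2 * L := by
    have hxx : x + y ≤ x * x := by nlinarith
    calc Real.log (x + y) ≤ Real.log (x * x) := Real.log_le_log (by positivity) hxx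
      _ = 2 * L := by rw [Real.log_mul hx0.ne' hx0.ne']; ring
  have hlog0 : 0 ≤ Real.log (x + y) := Real.log_nonneg (by linarith)
  have h2a : 2 * Real.sqrt (x + y) * Real.log (x + y) / L ≤ 6 * Real.sqrt x := by
    rw [div_le_iff₀ hL0]
    calc 2 * Real.sqrt (x + y) * Real.log (x + y) ≤ 2 * (3 / 2 * Real.sqrt x) * (2 * L) := by
          gcongr
      _ = 6 * Real.sqrt x * L := by ring
  have h2b : Real.sqrt x ≤ y * E := by
    calc Real.sqrt x = x ^ (1 / 2 : ℝ) := Real.sqrt_eq_rpow x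
      _ ≤ x ^ ((17 / 30 : ℝ) + -(1 / 100)) :=
          Real.rpow_le_rpow_of_exponent_le hx1.le (by norm_num)
      _ = x ^ (17 / 30 : ℝ) * x ^ (-(1 / 100) : ℝ) := Real.rpow_add hx0 _ _
      _ ≤ x ^ (17 / 30 + ε) * E :=
          mul_le_mul (Real.rpow_le_rpow_of_exponent_le hx1.le (by linarith)) hEx
            (by positivity) (by positivity)
      _ ≤ y * E := by gcongr
  -- term 3: `y²/(x L²) ≤ y x^{-1/100} ≤ y E`
  have h3 : y ^ 2 / (x * L ^ 2) ≤ y * E := by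
    have hL2 : 1 ≤ L ^ 2 := one_le_pow₀ hL1
    calc y ^ 2 / (x * L ^ 2) ≤ y ^ 2 / (x * 1) := by
          apply div_le_div_of_nonneg_left (by positivity) (by positivity)
          gcongr
      _ = y * (y / x) := by rw [mul_one, pow_two, mul_div_assoc]
      _ ≤ y * (x ^ (99 / 100 : ℝ) / x) := by gcongr
      _ = y * x ^ (-(1 / 100) : ℝ) := by
          congr 1
          rw [show (-(1 / 100) : ℝ) = 99 / 100 - 1 by norm_num, Real.rpow_sub hx0, Real.rpow_one]
      _ ≤ y * E := by gcongr
  -- assemble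
  have hpt := PrimeWindow.abs_primeCounting_window_sub_le_of_psi hx1 hy0.le
  rw [add_div] at hpt
  have hyE : 0 ≤ y * E := by positivity
  calc |(π ⌊x + y⌋₊ : ℝ) - π ⌊x⌋₊ - y / L|
      ≤ max C 0 * y * E + 6 * (y * E) + y * E := by
        linarith [hpt, h1, h2a, h2b, h3]
    _ = (max C 0 + 7) * y * E := by ring

end Literature.NumberTheory.LFunctions
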